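import Literature.Algebra.Homology.LefschetzNumberShift
import Literature.Algebra.Homology.LefschetzNumberShortExact
import Literature.Algebra.Homology.EulerCharacteristicMappingCone
import Mathlib.Algebra.Homology.HomotopyCategory.Pretriangulated
import HarnessLib

/-!
# `Λ(cone) = Λ(ψ) − Λ(φ)` — the Lefschetz number of the map induced on a mapping cone (LEAF B of (E-16))

Layer `Literature/Algebra/Homology` (pure linear algebra over Mathlib; proved theorems only, 0 definitions, 0 named facts,
no instances, no notation). The TRACE twin of row `EulerCharacteristicMappingCone` (`χ(cone φ) = χ(G) − χ(F)`) for row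
`LefschetzNumber`'s `lefschetzNumber`: for a commutative square of cochain complexes of finite-dimensional vector spaces with
finitely many non-zero terms

  `f : F ⟶ G`, `φ : F ⟶ F`, `ψ : G ⟶ G`, `f ≫ ψ = φ ≫ f`,

Mathlib's induced map of mapping cones `CochainComplex.mappingCone.map f f φ ψ comm : cone f ⟶ cone f` satisfies
**`lefschetzNumber_mappingCone_map : Λ(mappingCone.map f f φ ψ comm) = Λ(ψ) − Λ(φ)`**.
Proof BY NAME: the rotated standard triangle `G ⟶ cone f ⟶ F⟦1⟧` is a short exact sequence of complexes (row
`EulerCharacteristicMappingCone`'s `shortExact_triangleRotateShortComplex`), it carries the endomorphism `(ψ, cone-map, φ⟦1⟧')`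
(commutativities of Mathlib's `mappingCone.triangleMap`), row `LefschetzNumberShortExact`'s `lefschetzNumber_X₂_eq_add` gives
`Λ(cone-map) = Λ(ψ) + Λ(φ⟦1⟧')`, and LEAF A (`LefschetzNumberShift`) gives `Λ(φ⟦1⟧') = −Λ(φ)`. Also the chain-level form
`finsum_negOnePow_smul_trace_mappingCone_map_f`. With `φ = ψ = 𝟙` this is row `EulerCharacteristicMappingCone`, not restated.
Library only (cell `pub-hodge-ring2`, count-neutral); proves nothing about any crux, route or conjecture.

## References

* A. Hatcher, *Algebraic Topology* (2002), §2.C (Lefschetz number). [HatcherAT2002]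
* C. A. Weibel, *An introduction to homological algebra* (1994), §1.5 and §10.2 (mapping cones and their triangles). [Weibel1994]
-/

open CategoryTheory CategoryTheory.Limits CochainComplex

universe v u

namespace Literature.Algebra.Homology.Lefschetz

variable {K : Type u} [Field K] {F G : CochainComplex (ModuleCat.{v} K) ℤ} (f : F ⟶ G) (φ : F ⟶ F) (ψ : G ⟶ G)
  (comm : f ≫ ψ = φ ≫ f)

/-- The endomorphism `(ψ, cone-map, φ⟦1⟧')` of the rotated triangle `G ⟶ cone f ⟶ F⟦1⟧` commutes with its two maps
(Mathlib's `mappingCone.triangleMap`). [cite: Weibel1994, §10.2] -/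
theorem mappingCone_map_comm :
    (ψ ≫ (mappingCone.triangleRotateShortComplex f).f =
        (mappingCone.triangleRotateShortComplex f).f ≫ mappingCone.map f f φ ψ comm) ∧
      (mappingCone.map f f φ ψ comm ≫ (mappingCone.triangleRotateShortComplex f).g =
        (mappingCone.triangleRotateShortComplex f).g ≫ (CategoryTheory.shiftFunctor _ (1 : ℤ)).map φ) :=
  ⟨(mappingCone.triangleMap f f φ ψ comm).comm₂.symm, (mappingCone.triangleMap f f φ ψ comm).comm₃.symm⟩

/-- **`Λ(mappingCone.map f f φ ψ comm) = Λ(ψ) − Λ(φ)`** for a commutative square `f ≫ ψ = φ ≫ f` of endomorphisms of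
cochain complexes of finite-dimensional vector spaces with finitely many non-zero terms.
[cite: HatcherAT2002, §2.C] [cite: Weibel1994, §1.5 and §10.2] -/
theorem lefschetzNumber_mappingCone_map [∀ i, Module.Finite K (F.X i)] [∀ i, Module.Finite K (G.X i)]
    (hF : (GradedObject.finrankSupport F.X).Finite) (hG : (GradedObject.finrankSupport G.X).Finite) :
    lefschetzNumber (mappingCone.map f f φ ψ comm) = lefschetzNumber ψ - lefschetzNumber φ := by
  haveI : ∀ i, Module.Finite K ((mappingCone.triangleRotateShortComplex f).X₁.X i) :=
    fun i => inferInstanceAs (Module.Finite K (G.X i))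
  haveI : ∀ i, Module.Finite K ((mappingCone.triangleRotateShortComplex f).X₃.X i) :=
    fun i => EulerCharShift.moduleFinite_shift_X F 1 i
  let τ : mappingCone.triangleRotateShortComplex f ⟶ mappingCone.triangleRotateShortComplex f :=
    ShortComplex.homMk ψ (mappingCone.map f f φ ψ comm) ((CategoryTheory.shiftFunctor _ (1 : ℤ)).map φ)
      (mappingCone_map_comm f φ ψ comm).1 (mappingCone_map_comm f φ ψ comm).2
  have h := lefschetzNumber_X₂_eq_add (EulerCharMappingCone.shortExact_triangleRotateShortComplex f) τ hG
    (EulerCharShift.finrankSupport_shift_X_finite F 1 hF)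
  have h3 : lefschetzNumber τ.τ₃ = -lefschetzNumber φ := by
    change lefschetzNumber ((CategoryTheory.shiftFunctor _ (1 : ℤ)).map φ) = _
    rw [lefschetzNumber_shift, Int.negOnePow_one, Units.val_neg, Units.val_one, neg_one_zsmul]
  rw [h3] at h
  exact h.trans (sub_eq_add_neg _ _).symm

/-- **Chain level**: `Σᶠ n, (−1)ⁿ • tr((cone-map)ⁿ) = Σᶠ n, (−1)ⁿ • tr(ψⁿ) − Σᶠ n, (−1)ⁿ • tr(φⁿ)` (Hopf on the three complexes).
[cite: HatcherAT2002, Thm. 2C.3] -/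
theorem finsum_negOnePow_smul_trace_mappingCone_map_f [∀ i, Module.Finite K (F.X i)] [∀ i, Module.Finite K (G.X i)]
    (hF : (GradedObject.finrankSupport F.X).Finite) (hG : (GradedObject.finrankSupport G.X).Finite) :
    ∑ᶠ n : ℤ, (n.negOnePow : ℤ) • LinearMap.trace K ((mappingCone f).X n) ((mappingCone.map f f φ ψ comm).f n).hom =
      ∑ᶠ n : ℤ, (n.negOnePow : ℤ) • LinearMap.trace K (G.X n) (ψ.f n).hom -
        ∑ᶠ n : ℤ, (n.negOnePow : ℤ) • LinearMap.trace K (F.X n) (φ.f n).hom := by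
  haveI : ∀ i, Module.Finite K ((mappingCone.triangleRotateShortComplex f).X₁.X i) :=
    fun i => inferInstanceAs (Module.Finite K (G.X i))
  haveI : ∀ i, Module.Finite K ((mappingCone.triangleRotateShortComplex f).X₃.X i) :=
    fun i => EulerCharShift.moduleFinite_shift_X F 1 i
  haveI : ∀ i, Module.Finite K ((mappingCone f).X i) := fun i =>
    EulerCharShortExact.moduleFinite_X_X₂ (EulerCharMappingCone.shortExact_triangleRotateShortComplex f) i
  have hC : (GradedObject.finrankSupport (mappingCone f).X).Finite :=
    ((hG.union (EulerCharShift.finrankSupport_shift_X_finite F 1 hF)).subset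
      (EulerCharShortExact.finrankSupport_X₂_subset (EulerCharMappingCone.shortExact_triangleRotateShortComplex f)))
  have h := lefschetzNumber_mappingCone_map f φ ψ comm hF hG
  rw [lefschetzNumber_eq_finsum_χ_smul_trace_f _ hC, lefschetzNumber_eq_finsum_χ_smul_trace_f _ hG,
    lefschetzNumber_eq_finsum_χ_smul_trace_f _ hF] at h
  simpa only [ComplexShape.χ, ComplexShape.eulerCharSignsUpInt_χ] using h

end Literature.Algebra.Homology.Lefschetz
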